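import Summits.ResolutionOfSingularities.ResolutionOfSingularities.Theorems.FrobeniusLadderFInjectiveMacaulayficationCoordinateSlicing
import Summits.ResolutionOfSingularities.ResolutionOfSingularities.Theorems.FrobeniusLadderFInjectiveMacaulayficationFedderAtMaximalIdeal
import Summits.ResolutionOfSingularities.ResolutionOfSingularities.Theorems.FrobeniusLadderFInjectiveMacaulayficationHypersurfaceRegular
import Summits.ResolutionOfSingularities.ResolutionOfSingularities.Theorems.FrobeniusLadderFInjectiveMacaulayficationFiClauseOfRegular
import Mathlib.Algebra.MvPolynomial.PDeriv
import Mathlib.Algebra.MvPolynomial.Degrees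
import Mathlib.Algebra.CharP.Lemmas
import Mathlib.Data.Nat.Choose.Sum
import HarnessLib

/-!
# Fedder's test through a slicing: ONE extracted coefficient, read against a base hypersurface (generic certificate)
# (crux `FInjectiveMacaulayfication`, line `graded-engine`; infrastructure for cone / off-origin clauses along singular strata)

Support file for crux stmt-ResolutionOfSingularities-15315 (`FrobeniusLadder.FInjectiveMacaulayfication`), chain w45a,
seat res-L1-w45a-stub-3. [OURS · L1 W4.5a] — NOT a statement of the manuscript; AI-written, weaker than expert review.

The calibration certificates `HFedderCertificates.clause_plane_char5` / `clause_axis_char5`, `S1FaceConeClause.clause_cuspCurve_char2`,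
`G1TailFilteredFiModel.clause_doubleLine_oddChar` all run the same argument; this file states it ONCE, for every prime `p`, any
slicing `Ψ : k[X] ≃+* B[Y]` (`CoordinateSlicing`) and any hypersurface `F`:

* `coeff_X_pow_add_pow` — COEFFICIENT BOOKKEEPING for binomial expansions: if `u` does not involve `Y_s` (`degreeOf s u = 0`) and
  `e_s = 0`, then `coeff_{s^{αi} · e} (Y_s^α + u)^n = C(n,i) · coeff_e (u^{n-i})` — iterate it to read off the one coefficient of
  `F^{p-1}` a certificate needs (e.g. `HFedderCertificates`, `G1TailFilteredFiModel.coeff_doubleLine_pow`);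
* `clause_of_sliceCoeff` — **THE GENERIC CERTIFICATE**: let `Q` be a maximal ideal of `k[X]/(F)` whose contraction `P` contains the
  slice variables, `𝔭 = P ∩ B` the base point, and suppose the `Y^d`-coefficient (`d_s < p`) of `Ψ(F^{p-1})` is `u · φ^m` with `u` a
  unit of `B` and `m ≤ p - 1`. If EITHER `φ ∉ 𝔭` OR some `∂φ/∂X_i ∉ 𝔭`, then `(k[X]/(F))_Q` satisfies the Cohen–Macaulay +
  Frobenius-closed clause. Proof: were `F^{p-1} ∈ P^[p]`, coefficient extraction (`CoordinateSlicing.coeff_mem_span_of_mem_span`) gives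
  `φ^m ∈ 𝔭^[p] ⊆ 𝔭`, so `φ ∈ 𝔭`; then `∂ᵢφ ∉ 𝔭` makes the base hypersurface `B_𝔭/(φ)` REGULAR (`HypersurfaceRegular`), hence
  clause-good (`FiClauseOfRegular`), hence — Fedder's criterion read BACKWARDS (`FedderAtMaximalIdeal.fedder_criterion_maximalIdeal`) —
  `φ^{p-1} ∉ 𝔭^[p]`, contradicting `φ^m ∈ 𝔭^[p]`, `m ≤ p-1`. With `φ = X_j` (first alternative) this is the AXIS / double-LINE case;
  with `φ` a plane curve it is the PLANE / cusp-CURVE case; in general it certifies the clause along any stratum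
  `{slices = 0} × {φ = 0}` off `{φ = ∂φ = 0}`.

All proofs are glue on Mathlib and landed files; no definitions, no named facts. References: [Fedder1983] R. Fedder, *F-purity and
rational singularity*, Trans. AMS 278 (1983), Prop. 1.7, Thm. 1.12 (through the imported criterion). [folklore]
-/

-- single-problem summit: the doubled namespace component is forced
set_option linter.dupNamespace false

noncomputable section

namespace Summit.ResolutionOfSingularities.ResolutionOfSingularities.Theorems.FInjectiveMacaulayfication.FedderViaSlicing

open MvPolynomial IsLocalRing
open Summit.ResolutionOfSingularities.ResolutionOfSingularities.Theorems.FInjectiveMacaulayfication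

/-! ## Coefficient bookkeeping for binomial expansions -/

/-- A polynomial not involving `Y_s` has no monomial with positive `s`-exponent, and neither have its powers. [folklore] -/
theorem coeff_eq_zero_of_degreeOf_eq_zero {σ B : Type*} [CommSemiring B] (s : σ) (u : MvPolynomial σ B)
    (hu : degreeOf s u = 0) (t : ℕ) (m : σ →₀ ℕ) (hm : 0 < m s) : coeff m (u ^ t) = 0 := by
  classical
  by_contra h
  have hmem : m ∈ (u ^ t).support := mem_support_iff.mpr h
  have h1 := monomial_le_degreeOf s hmem
  have h2 : degreeOf s (u ^ t) ≤ t * degreeOf s u := degreeOf_pow_le s u t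
  rw [hu, mul_zero] at h2
  omega

/-- **Coefficient of `Y_s^{αi}·Y^e` in `(Y_s^α + u)^n`** when `u` does not involve `Y_s` and `e_s = 0`: only the `i`-th binomial
term contributes, giving `C(n,i) · coeff_e (u^{n-i})`. [folklore] -/
theorem coeff_X_pow_add_pow {σ B : Type*} [CommRing B] (s : σ) (α n i : ℕ) (hα : 0 < α) (hi : i ≤ n)
    (u : MvPolynomial σ B) (hu : degreeOf s u = 0) (e : σ →₀ ℕ) (he : e s = 0) :
    coeff (Finsupp.single s (α * i) + e) ((X s ^ α + u) ^ n) = (n.choose i : B) * coeff e (u ^ (n - i)) := by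
  classical
  rw [add_pow, coeff_sum, Finset.sum_eq_single i]
  · -- the `i`-th term
    rw [← pow_mul, X_pow_eq_monomial, mul_assoc, coeff_monomial_mul', if_pos le_self_add, add_tsub_cancel_left, one_mul,
      ← map_natCast (C : B →+* MvPolynomial σ B), mul_comm (u ^ (n - i)) (C _), coeff_C_mul]
  · -- the other terms vanish
    intro j _ hj
    rw [← pow_mul, X_pow_eq_monomial, mul_assoc, coeff_monomial_mul']
    rcases Nat.lt_or_gt_of_ne hj with hlt | hgt
    · -- `j < i`: the shifted exponent is positive at `s`, but `u^(n-j)` does not involve `Y_s`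
      rw [if_pos, one_mul, ← map_natCast (C : B →+* MvPolynomial σ B), mul_comm (u ^ (n - j)) (C _), coeff_C_mul,
        coeff_eq_zero_of_degreeOf_eq_zero s u hu, mul_zero]
      · simp only [Finsupp.coe_tsub, Finsupp.coe_add, Pi.sub_apply, Pi.add_apply, Finsupp.single_eq_same, he]
        have : α * j < α * i := Nat.mul_lt_mul_of_pos_left hlt hα
        omega
      · intro t
        simp only [Finsupp.coe_add, Pi.add_apply, Finsupp.single_apply]
        split_ifs with h
        · subst h
          exact le_add_right (Nat.mul_le_mul_left α hlt.le)
        · exact Nat.zero_le _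
    · -- `i < j`: `Y_s^{αj}` does not divide `Y_s^{αi}·Y^e`
      rw [if_neg]
      intro hle
      have h1 := hle s
      simp only [Finsupp.coe_add, Pi.add_apply, Finsupp.single_eq_same, he, add_zero] at h1
      have : α * i < α * j := Nat.mul_lt_mul_of_pos_left hgt hα
      omega
  · intro hn
    exact absurd (Finset.mem_range.mpr (by omega)) hn

/-! ## The generic certificate -/

/-- **FEDDER'S TEST THROUGH A SLICING, read against a base hypersurface.** `Ψ : k[X] ≃+* B[Y]` a slicing, `F ≠ 0`, `Q` a maximal
ideal of `k[X]/(F)` whose contraction contains the slice variables, `𝔭 = P ∩ B`; if the `Y^d`-coefficient (`d_s < p`) of `Ψ(F^{p-1})`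
is `u·φ^m` with `u ∈ B^×`, `m ≤ p-1`, and either `φ ∉ 𝔭` or some `∂ᵢφ ∉ 𝔭`, then `(k[X]/(F))_Q` satisfies the Cohen–Macaulay +
Frobenius-closed clause (coefficient extraction + Fedder's criterion read backwards on the regular base hypersurface `B_𝔭/(φ)`).
[cite: Fedder1983, Thm. 1.12] -/
theorem clause_of_sliceCoeff (p : ℕ) [hp : Fact p.Prime] (k : Type) [Field k] [CharP k p] {n r r' : ℕ}
    (Ψ : MvPolynomial (Fin n) k ≃+* MvPolynomial (Fin r) (MvPolynomial (Fin r') k))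
    (F : MvPolynomial (Fin n) k) (hF0 : F ≠ 0)
    (Q : Ideal (MvPolynomial (Fin n) k ⧸ Ideal.span {F})) [Q.IsMaximal]
    (hy : ∀ s : Fin r, Ψ.symm (X s) ∈ Q.comap (Ideal.Quotient.mk (Ideal.span {F})))
    (d : Fin r →₀ ℕ) (hd : ∀ s, d s < p) (u φ : MvPolynomial (Fin r') k) (hu : IsUnit u) (m : ℕ) (hm : m ≤ p - 1)
    (hcoeff : coeff d (Ψ (F ^ (p - 1))) = u * φ ^ m)
    (hφ : φ ∉ (Q.comap (Ideal.Quotient.mk (Ideal.span {F}))).comap (Ψ.symm.toRingHom.comp C) ∨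
      ∃ i : Fin r', pderiv i φ ∉ (Q.comap (Ideal.Quotient.mk (Ideal.span {F}))).comap (Ψ.symm.toRingHom.comp C)) :
    ∀ e : ℕ, ringKrullDim (Localization.AtPrime Q) = e → ∀ s : Fin e → Localization.AtPrime Q,
      (Ideal.span (Set.range s)).radical.IsMaximal →
        RingTheory.Sequence.IsWeaklyRegular (Localization.AtPrime Q) (List.ofFn s) ∧
        ∀ y : Localization.AtPrime Q, (∃ t : ℕ, y ^ p ^ t ∈ Ideal.span
          ((fun z : Localization.AtPrime Q => z ^ p ^ t) ''
            (Ideal.span (Set.range s) : Set (Localization.AtPrime Q)))) → y ∈ Ideal.span (Set.range s) := by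
  haveI hPmax : (Q.comap (Ideal.Quotient.mk (Ideal.span {F}))).IsMaximal :=
    Ideal.comap_isMaximal_of_surjective _ Ideal.Quotient.mk_surjective
  -- the base point and its generators
  haveI h𝔭 : ((Q.comap (Ideal.Quotient.mk (Ideal.span {F}))).comap (Ψ.symm.toRingHom.comp C)).IsMaximal :=
    CoordinateSlicing.comap_slice_isMaximal Ψ _ hy
  obtain ⟨m', a, ha⟩ := Submodule.fg_iff_exists_fin_generating_family.mp
    (IsNoetherian.noetherian ((Q.comap (Ideal.Quotient.mk (Ideal.span {F}))).comap (Ψ.symm.toRingHom.comp C)))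
  have hPA := CoordinateSlicing.eq_span_sliceFamily Ψ _ hy a ha
  refine FedderAtMaximalIdeal.stub_fedderAtMaximalIdeal p k n (r + m') _ F Q hPA hF0 ?_
  -- Fedder's test
  intro hmem
  have hext := CoordinateSlicing.coeff_mem_span_of_mem_span Ψ d p hd a hmem
  rw [hcoeff] at hext
  have hφm : φ ^ m ∈ Ideal.span (Set.range fun j => a j ^ p) := (Ideal.unit_mul_mem_iff_mem _ hu).mp hext
  have h𝔞 : Ideal.span (Set.range fun j => a j ^ p) ≤
      (Q.comap (Ideal.Quotient.mk (Ideal.span {F}))).comap (Ψ.symm.toRingHom.comp C) := by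
    rw [Ideal.span_le]
    rintro _ ⟨j, rfl⟩
    refine Ideal.pow_mem_of_mem _ ?_ p hp.out.pos
    rw [← ha]
    exact Ideal.subset_span (Set.mem_range_self j)
  have key : φ ∈ (Q.comap (Ideal.Quotient.mk (Ideal.span {F}))).comap (Ψ.symm.toRingHom.comp C) :=
    h𝔭.isPrime.mem_of_pow_mem m (h𝔞 hφm)
  rcases hφ with hφ | ⟨i, hdi⟩
  · exact hφ key
  · -- the base hypersurface `B_𝔭/(φ)` is regular, hence clause-good; Fedder backwards
    have hφ0 : φ ≠ 0 := by
      intro h0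
      apply hdi
      rw [h0, map_zero]
      exact Ideal.zero_mem _
    haveI hreg := HypersurfaceRegular.isRegularLocalRing_localization_quotient_of_pderiv_not_mem k r' φ i
      ((Q.comap (Ideal.Quotient.mk (Ideal.span {F}))).comap (Ψ.symm.toRingHom.comp C)) key hdi
    haveI : CharP (Localization.AtPrime ((Q.comap (Ideal.Quotient.mk (Ideal.span {F}))).comap
        (Ψ.symm.toRingHom.comp C)) ⧸ Ideal.span {algebraMap (MvPolynomial (Fin r') k)
          (Localization.AtPrime ((Q.comap (Ideal.Quotient.mk (Ideal.span {F}))).comap (Ψ.symm.toRingHom.comp C))) φ}) p :=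
      charP_of_injective_ringHom (((Ideal.Quotient.mk _).comp ((algebraMap (MvPolynomial (Fin r') k) _).comp
        (algebraMap k (MvPolynomial (Fin r') k)))).injective) p
    have hclause := (FiClauseOfRegular.stub_fiClauseOfRegular p (Localization.AtPrime ((Q.comap
      (Ideal.Quotient.mk (Ideal.span {F}))).comap (Ψ.symm.toRingHom.comp C)) ⧸ Ideal.span
        {algebraMap (MvPolynomial (Fin r') k) (Localization.AtPrime ((Q.comap (Ideal.Quotient.mk
          (Ideal.span {F}))).comap (Ψ.symm.toRingHom.comp C))) φ})).2
    have hnot := (FedderAtMaximalIdeal.fedder_criterion_maximalIdeal k r' m' p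
      ((Q.comap (Ideal.Quotient.mk (Ideal.span {F}))).comap (Ψ.symm.toRingHom.comp C)) a ha.symm φ key hφ0).mp hclause
    refine hnot ?_
    rw [← Nat.sub_add_cancel hm, pow_add]
    exact Ideal.mul_mem_left _ _ hφm

end Summit.ResolutionOfSingularities.ResolutionOfSingularities.Theorems.FInjectiveMacaulayfication.FedderViaSlicing

end
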